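import Summits.ValiantsHypothesis.ValiantsHypothesis.Theorems.LacunarySymmetroidMatrixDescartesCensusAtomM7K5EB104
import Summits.ValiantsHypothesis.ValiantsHypothesis.Theorems.LacunarySymmetroidMatrixDescartesCensusAtomM7K4QF70
import Summits.ValiantsHypothesis.ValiantsHypothesis.Theorems.LacunarySymmetroidMatrixDescartesCensusAtomM7K3S73
import Summits.ValiantsHypothesis.ValiantsHypothesis.Theorems.LacunarySymmetroidMatrixDescartesCensusRowLawM4

/-!
# `MatrixDescartes` census — THE `m = 7` ROW LAW: `ζ_sym(7,K) ≥ 104·⌊(K−1)/4⌋ + {0, 7, 35, 70}` for EVERY `K ≥ 5` (slope `26` per letter)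

HONEST FRAMING.  Experiment cell `val-V1-extremal`, width seat val-v1x-eng-9 g3 (`--supports stmt-ValiantsHypothesis-18050 --as helper`).
LOWER-bound / construction mathematics in census (CONJECTURE-A) currency: explicit real symmetric lacunary `7 × 7` pencils with many distinct
positive determinant roots, for every number of letters `K`.  It proves NOTHING about the crux `Theses.LacunarySymmetroid.MatrixDescartes`
(stmt-ValiantsHypothesis-18050 — an UPPER bound at fat formats; a fixed-`m` row is polynomial in `K`), nothing about `DoorA26` / `DoorA34`,
nothing about `VP ≠ VNP`; VP ≠ VNP is NOT proved.  No definitions, no `sorry`.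

THE LAW.  For every `K ≥ 5`, writing `K − 1 = 4q + r` (`0 ≤ r < 4`): `ζ_sym(7,K) ≥ 104q + c_r` with `c = (0, 7, 35, 70)` (`row_r0` … `row_r3`),
`K`-slope `26` per letter; closed forms `rowLaw` (`104·⌊(K−1)/4⌋ + 7·((K−1) mod 4)`) and `rowLaw_linear` (`26K − 45`).

Before this file the tree's all-`K` statements at `m = 7` were `VSQ.gen_law` (`19K − 37`, slope `19`) and the `P4` chain ladder (`63` per `3` letters,
slope `21`); the finite block words of val-v1x-eng-8 g3 (`MixM7`: `(7,8) 174`, `(7,11) 244`, `(7,12) 278`, `(7,13) 312`) are exactly the cells `K ≤ 13`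
of this ladder — new here is the statement for every `K`.  SUB-`P`: `P(7,K) = 28K − 49` has slope `28 > 26`, so this row falls below the parameter
count from `K = 14` on (`(7,13) ≥ 312 < P + 1 = 316` already); the cell's located atoms do not decide «P-tracking» at `m = 7` (cf. `…CensusSuperPSmallM`).

MECHANISM (bookkeeping over kernel-certified blocks of val-v1x-eng-8 g3's atom bank; `Chain.chain_append` = the tree's junction law for matching
junction inertia, seat val-sym-mdr-p1).  Period = val-v1x-eng-2 g2's `ENDBOTH104` (`(7,5) ≥ 104`, block `AtomM7K5EB104`, end inertias `(4,3)/(4,3)` —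
self-matching): `q + 1` periods = `4q + 5` letters, `104(q+1)` alternations (`chain`).  Terminal pieces on the free `(4,3)` end: one grafted letter
(`+7`), the pub-symmetroid lead's `(7,3)` native `S-7-3` negated (`AtomM7K3S73.blockNeg`, bottom `(4,3)`, `+2` letters, `+35`), eng-2's `QUADFLAG70`
(`AtomM7K4QF70.block`, `(4,3)/(4,3)`, `+3` letters, `+70`).
Credits: rows val-v1x-eng-2 g2 (ENDBOTH104, QUADFLAG70), pub-symmetroid lead (S-7-3); block kit + atom bank val-v1x-eng-8 g3; junction calculus val-sym-mdr-p1.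
[folklore] throughout (Sylvester's law of inertia, intermediate value theorem — inside the cited tree lemmas).
-/

-- `Summit.ValiantsHypothesis.ValiantsHypothesis.…` repeats a component by the D-0017 layout
-- (single-conjunct summit), which the `dupNamespace` linter flags; the name is mandated.
set_option linter.dupNamespace false

namespace Summit.ValiantsHypothesis.ValiantsHypothesis.Theorems.LacunarySymmetroidMatrixDescartes.Census.Reflect.RowLawM7

open Summit.ValiantsHypothesis.ValiantsHypothesis.Theorems.MatrixDescartes.Negative (PosRootLawAt)
open Summit.ValiantsHypothesis.ValiantsHypothesis.Theorems.LacunarySymmetroidMatrixDescartes.Census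
open Summit.ValiantsHypothesis.ValiantsHypothesis.Theorems.LacunarySymmetroidMatrixDescartes.Census.Reflect
open Summit.ValiantsHypothesis.ValiantsHypothesis.Theorems.LacunarySymmetroidMatrixDescartes.Census.Reflect.RowLawM4 (mono)
open scoped BigOperators Matrix

/-! ### The periodic ladder `E ▹ E ▹ …` (`E = AtomM7K5EB104`, self-matching ends `(4,3)`) -/

/-- **Ladder**: `q + 1` copies of `ENDBOTH104` — a chain with `4q + 5` letters, `104(q+1)` alternations and top Sylvester form of inertia `(4,3)`.
[folklore] -/
theorem chain (q : ℕ) : ∃ (d : Fin (4 * q + 4 + 1) → ℕ) (S : Fin (4 * q + 4 + 1) → Matrix (Fin 7) (Fin 7) ℝ)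
      (τ : Fin (104 * q + 104 + 1) → ℝ),
    StrictMono d ∧ (∀ h1 : 0 < 4 * q + 4 + 1, ∃ C : Matrix (Fin 7) (Fin 7) ℝ, C.det ≠ 0 ∧
      Cᵀ * S ⟨4 * q + 4 + 1 - 1, Nat.sub_lt h1 one_pos⟩ * C
        = Matrix.diagonal (![(1 : ℝ), (1 : ℝ), (1 : ℝ), (1 : ℝ), (-1 : ℝ), (-1 : ℝ), (-1 : ℝ)] : Fin 7 → ℝ)) ∧
    (∀ l, (S l).IsSymm) ∧ StrictMono τ ∧ (∀ j, 0 < τ j) ∧ (∀ j, (∑ l, τ j ^ d l • S l).det ≠ 0) ∧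
    ∀ j : Fin (104 * q + 104), (∑ l, τ j.castSucc ^ d l • S l).det * (∑ l, τ j.succ ^ d l • S l).det < 0 := by
  induction q with
  | zero =>
    exact Chain.certificateT_transport (by norm_num) (by norm_num) (Chain.chain_of_block AtomM7K5EB104.block)
  | succ q ih =>
    have h1 := Chain.chain_append (K₁ := 4 * q + 4) (K₂ := 4) (by norm_num) ih AtomM7K5EB104.block
      (Equiv.refl (Fin 7)) (by intro i; fin_cases i <;> norm_num)
    exact Chain.certificateT_transport (by ring) (by ring) h1

/-! ### Rows by residue of `K − 1 (mod 4)` -/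

/-- **`K = 4q+5`: `ζ_sym(7, 4q+5) ≥ 104(q+1)`** (`q = 0` is `ENDBOTH104`, `q = 1` the self-chain `(7,9) ≥ 208`, `q = 2` is `(7,13) ≥ 312`). [folklore] -/
theorem row_r0 (q : ℕ) : ¬ PosRootLawAt 7 (4 * q + 5) (104 * q + 103) := by
  have h := Chain.not_posRootLawAt_of_certificateT (by omega) (chain q)
  rw [show 4 * q + 5 = 4 * q + 4 + 1 by ring, show 104 * q + 103 = 104 * q + 104 - 1 by omega]
  exact h

/-- **`K = 4q+6`: `ζ_sym(7, 4q+6) ≥ 104(q+1) + 7`** (one grafted letter). [folklore] -/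
theorem row_r1 (q : ℕ) : ¬ PosRootLawAt 7 (4 * q + 6) (104 * q + 110) := by
  have h := not_posRootLawAt_of_certificateT_add (by omega) (chain q) 1
  rw [show 4 * q + 6 = 4 * q + 4 + 1 + 1 by ring, show 104 * q + 110 = 104 * q + 104 + 1 * 7 - 1 by omega]
  exact h

/-- **`K = 4q+7`: `ζ_sym(7, 4q+7) ≥ 104(q+1) + 35`** (terminal block = the `(7,3)` native `S-7-3` negated, bottom inertia `(4,3)`). [folklore] -/
theorem row_r2 (q : ℕ) : ¬ PosRootLawAt 7 (4 * q + 7) (104 * q + 138) := by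
  have h := Chain.not_posRootLawAt_of_certificateT (by omega)
    (Chain.chain_append (K₁ := 4 * q + 4) (K₂ := 2) (by norm_num) (chain q) AtomM7K3S73.blockNeg
      (Equiv.refl (Fin 7)) (by intro i; fin_cases i <;> norm_num))
  rw [show 4 * q + 7 = 4 * q + 4 + 2 + 1 by ring, show 104 * q + 138 = 104 * q + 104 + 35 - 1 by omega]
  exact h

/-- **`K = 4q+8`: `ζ_sym(7, 4q+8) ≥ 104(q+1) + 70`** (terminal block = `QUADFLAG70`; `q = 0` is the kernel's `(7,8) ≥ 174`). [folklore] -/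
theorem row_r3 (q : ℕ) : ¬ PosRootLawAt 7 (4 * q + 8) (104 * q + 173) := by
  have h := Chain.not_posRootLawAt_of_certificateT (by omega)
    (Chain.chain_append (K₁ := 4 * q + 4) (K₂ := 3) (by norm_num) (chain q) AtomM7K4QF70.block
      (Equiv.refl (Fin 7)) (by intro i; fin_cases i <;> norm_num))
  rw [show 4 * q + 8 = 4 * q + 4 + 3 + 1 by ring, show 104 * q + 173 = 104 * q + 104 + 70 - 1 by omega]
  exact h

/-! ### The law -/

/-- **THE `m = 7` ROW LAW (closed form).**  For every `K ≥ 5`: `¬ PosRootLawAt 7 K (104·⌊(K−1)/4⌋ + 7·((K−1) mod 4) − 1)` — some real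
symmetric `K`-letter `7 × 7` lacunary pencil has at least `104·⌊(K−1)/4⌋ + 7·((K−1) mod 4)` distinct positive determinant roots (the residue rows
`row_r2` / `row_r3` are sharper: `+35`, `+70` instead of `+14`, `+21`).  A LOWER bound in census currency; nothing about the crux `MatrixDescartes`.
[folklore] -/
theorem rowLaw (K : ℕ) (hK : 5 ≤ K) : ¬ PosRootLawAt 7 K (104 * ((K - 1) / 4) + 7 * ((K - 1) % 4) - 1) := by
  obtain ⟨q, r, hr, rfl⟩ : ∃ q r, r < 4 ∧ K = 4 * q + 5 + r :=
    ⟨(K - 5) / 4, (K - 5) % 4, Nat.mod_lt _ (by norm_num), by omega⟩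
  rcases hr_cases : r with _ | _ | _ | _ | r'
  · exact mono (row_r0 q) (by omega)
  · exact mono (row_r1 q) (by omega)
  · exact mono (row_r2 q) (by omega)
  · exact mono (row_r3 q) (by omega)
  · omega

/-- **Linear form**: `ζ_sym(7,K) ≥ 26K − 45` for every `K ≥ 5` (`¬ PosRootLawAt 7 K (26K − 46)`; the worst residue is `K ≡ 2 (mod 4)`, where it
is attained: `ζ(7,4q+6) ≥ 104q + 111`) — against the tree's `VSQ.gen_law` `19K − 37`. [folklore] -/
theorem rowLaw_linear (K : ℕ) (hK : 5 ≤ K) : ¬ PosRootLawAt 7 K (26 * K - 46) := by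
  obtain ⟨q, r, hr, rfl⟩ : ∃ q r, r < 4 ∧ K = 4 * q + 5 + r :=
    ⟨(K - 5) / 4, (K - 5) % 4, Nat.mod_lt _ (by norm_num), by omega⟩
  rcases hr_cases : r with _ | _ | _ | _ | r'
  · exact mono (row_r0 q) (by omega)
  · exact mono (row_r1 q) (by omega)
  · exact mono (row_r2 q) (by omega)
  · exact mono (row_r3 q) (by omega)
  · omega

/-! ### Numeral cells beyond the kernel's table (census format `(m,K) ≥ B + 1` reads `¬ PosRootLawAt m K B`) -/

/-- `ζ_sym(7,14) ≥ 319`. [folklore] -/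
theorem row_7_14 : ¬ PosRootLawAt 7 14 318 := row_r1 2

/-- `ζ_sym(7,15) ≥ 347`. [folklore] -/
theorem row_7_15 : ¬ PosRootLawAt 7 15 346 := row_r2 2

/-- `ζ_sym(7,16) ≥ 382`. [folklore] -/
theorem row_7_16 : ¬ PosRootLawAt 7 16 381 := row_r3 2

/-- `ζ_sym(7,17) ≥ 416`. [folklore] -/
theorem row_7_17 : ¬ PosRootLawAt 7 17 415 := row_r0 3

end Summit.ValiantsHypothesis.ValiantsHypothesis.Theorems.LacunarySymmetroidMatrixDescartes.Census.Reflect.RowLawM7
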